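import Literature.Analysis.Calculus.ExpDifferentialAdSeries
import HarnessLib

/-!
# Prop 7, route-R E′, (E1-c) brick F4a — EQUIVARIANCE OF THE RESUMMATION COEFFICIENT: `u·g(ad X)(H)·u⁻¹ = g(ad(uXu⁻¹))(uHu⁻¹)`

Route `UnitScaleTilt`, crux K1 child «MinimiserStabilityRegPr» (`stmt-QuantumFields-19200`), cell ym3-torus, width seat px15 (gen 2); pen «px15 g2: (E1-c) GO-LOCATE» (★p1 g15,
2026-08-28T20:45:05Z), LOCATE `LOCATE-E1C-DIVLIPSCHITZ-px15g2.md` §6 (F4: the `P₂` resummation uses F1 ✓p669426 `divB_siteCoeff_eq_of_equivariant`, whose hypothesis `hequiv`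
is exactly this conjugation-equivariance of the site coefficient `ĉ λ Z := (g(ad λ) − 1)Z`).  THEOREMS ONLY (0 `def`, 0 `sorry`); `--supports stmt-QuantumFields-19200`, count-neutral.
YM₃ on T³ is a ladder rung (R3), not the Clay problem; nothing here claims the stub, the crux, d = 4 or the mass gap.

WHAT IS PROVED (any complete normed `ℂ`-algebra `E`, `u : Eˣ`; conjugation written with Mathlib's `ContinuousLinearMap.mulLeftRight ℂ E ↑u ↑u⁻¹ : Z ↦ uZu⁻¹`):
* `mulLeftRight_conj_mul_ad` — `C_u ∘ ad X = ad(uXu⁻¹) ∘ C_u` (as elements of the operator algebra `E →L[ℂ] E`); `mulLeftRight_conj_mul_pow` — the same for powers of `−ad`;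
* ★ `mulLeftRight_conj_mul_gSer_ad` — `C_u ∘ g(ad X) = g(ad(uXu⁻¹)) ∘ C_u` (termwise on ✓ `ExpDifferential.hasSum_gSer`, uniqueness of sums);
* ★★ `conj_gSer_ad_apply` — `u·(g(ad X)H)·u⁻¹ = g(ad(uXu⁻¹))(uHu⁻¹)`, and `conj_gSerSubOne_apply` for the coefficient `M_X := g(ad X) − 1`: `u·(g(ad X)H − H)·u⁻¹ = g(ad X′)H′ − H′`.
HONEST SCOPE.  Elementary ([folklore]: conjugation is a continuous algebra automorphism).

References: T. Bałaban, CMP 98 (1985) 17–51 [Balaban1985Averaging] ((32)–(33) p.22); B. C. Hall, *Lie Groups, Lie Algebras, and Representations*, 2nd ed. (2015), Prop. 3.35 [Hall2015].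
-/

set_option autoImplicit false

noncomputable section

open NormedSpace
open scoped Nat

namespace Summit.QuantumFields.YangMills.Theorems.Prop7GSerAdEquivariance

open Literature.Analysis.Calculus.ExpDifferential (gSer ad mulL mulR hasSum_gSer)

variable {E : Type*} [NormedRing E] [NormedAlgebra ℂ E] [CompleteSpace E]

omit [CompleteSpace E] in
/-- `C_u(Z) = uZu⁻¹`. (bookkeeping) [folklore] -/
theorem mulLeftRight_conj_apply (u : Eˣ) (Z : E) : ContinuousLinearMap.mulLeftRight ℂ E (u : E) (↑u⁻¹ : E) Z = (u : E) * Z * (↑u⁻¹ : E) :=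
  ContinuousLinearMap.mulLeftRight_apply ℂ E _ _ _

omit [CompleteSpace E] in
/-- **`C_u ∘ ad X = ad(uXu⁻¹) ∘ C_u`.** [cite: Hall2015, Prop. 3.35] -/
theorem mulLeftRight_conj_mul_ad (u : Eˣ) (X : E) :
    ContinuousLinearMap.mulLeftRight ℂ E (u : E) (↑u⁻¹ : E) * ad ℂ X
      = ad ℂ ((u : E) * X * (↑u⁻¹ : E)) * ContinuousLinearMap.mulLeftRight ℂ E (u : E) (↑u⁻¹ : E) := by
  ext Z
  simp only [mul_apply_eq_comp, mulLeftRight_conj_apply, ad, mulL, mulR, sub_apply, ContinuousLinearMap.mul_apply',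
    ContinuousLinearMap.flip_apply, mul_sub, sub_mul, mul_assoc, Units.inv_mul_cancel_left]

omit [CompleteSpace E] in
/-- `C_u ∘ (−ad X)ⁿ = (−ad(uXu⁻¹))ⁿ ∘ C_u`. [folklore] -/
theorem mulLeftRight_conj_mul_pow (u : Eˣ) (X : E) (n : ℕ) :
    ContinuousLinearMap.mulLeftRight ℂ E (u : E) (↑u⁻¹ : E) * (-ad ℂ X) ^ n
      = (-ad ℂ ((u : E) * X * (↑u⁻¹ : E))) ^ n * ContinuousLinearMap.mulLeftRight ℂ E (u : E) (↑u⁻¹ : E) := by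
  have h : SemiconjBy (ContinuousLinearMap.mulLeftRight ℂ E (u : E) (↑u⁻¹ : E)) (-ad ℂ X) (-ad ℂ ((u : E) * X * (↑u⁻¹ : E))) :=
    (show SemiconjBy _ (ad ℂ X) (ad ℂ ((u : E) * X * (↑u⁻¹ : E))) from mulLeftRight_conj_mul_ad u X).neg_right
  exact (h.pow_right n).eq

/-- ★ **`C_u ∘ g(ad X) = g(ad(uXu⁻¹)) ∘ C_u`** (termwise, by uniqueness of sums). [cite: Balaban1985Averaging, (32)-(33) p.22] -/
theorem mulLeftRight_conj_mul_gSer_ad (u : Eˣ) (X : E) :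
    ContinuousLinearMap.mulLeftRight ℂ E (u : E) (↑u⁻¹ : E) * gSer ℂ (ad ℂ X)
      = gSer ℂ (ad ℂ ((u : E) * X * (↑u⁻¹ : E))) * ContinuousLinearMap.mulLeftRight ℂ E (u : E) (↑u⁻¹ : E) := by
  set C := ContinuousLinearMap.mulLeftRight ℂ E (u : E) (↑u⁻¹ : E) with hC
  have h1 : HasSum (fun n : ℕ => C * (((n + 1)!⁻¹ : ℂ) • (-ad ℂ X) ^ n)) (C * gSer ℂ (ad ℂ X)) :=
    (hasSum_gSer (𝕂 := ℂ) (ad ℂ X)).mul_left C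
  have h2 : HasSum (fun n : ℕ => (((n + 1)!⁻¹ : ℂ) • (-ad ℂ ((u : E) * X * (↑u⁻¹ : E))) ^ n) * C)
      (gSer ℂ (ad ℂ ((u : E) * X * (↑u⁻¹ : E))) * C) :=
    (hasSum_gSer (𝕂 := ℂ) (ad ℂ ((u : E) * X * (↑u⁻¹ : E)))).mul_right C
  have heq : (fun n : ℕ => C * (((n + 1)!⁻¹ : ℂ) • (-ad ℂ X) ^ n))
      = fun n : ℕ => (((n + 1)!⁻¹ : ℂ) • (-ad ℂ ((u : E) * X * (↑u⁻¹ : E))) ^ n) * C := by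
    funext n
    rw [ContinuousLinearMap.mul_def, ContinuousLinearMap.comp_smul, ContinuousLinearMap.mul_def, ContinuousLinearMap.smul_comp,
      ← ContinuousLinearMap.mul_def, ← ContinuousLinearMap.mul_def, hC, mulLeftRight_conj_mul_pow]
  rw [heq] at h1
  exact h1.unique h2

/-- ★★ **EQUIVARIANCE OF `g(ad X)`**: `u·(g(ad X)H)·u⁻¹ = g(ad(uXu⁻¹))(uHu⁻¹)`. [cite: Balaban1985Averaging, (32)-(33) p.22] -/
theorem conj_gSer_ad_apply (u : Eˣ) (X H : E) :
    (u : E) * gSer ℂ (ad ℂ X) H * (↑u⁻¹ : E) = gSer ℂ (ad ℂ ((u : E) * X * (↑u⁻¹ : E))) ((u : E) * H * (↑u⁻¹ : E)) := by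
  have h := congrArg (fun L : E →L[ℂ] E => L H) (mulLeftRight_conj_mul_gSer_ad u X)
  simpa only [mul_apply_eq_comp, mulLeftRight_conj_apply] using h

/-- ★★ The coefficient `M_X := g(ad X) − 1` is equivariant: `u·(g(ad X)H − H)·u⁻¹ = g(ad(uXu⁻¹))(uHu⁻¹) − uHu⁻¹`. [cite: Balaban1985Averaging, (32)-(33) p.22] -/
theorem conj_gSerSubOne_apply (u : Eˣ) (X H : E) :
    (u : E) * (gSer ℂ (ad ℂ X) H - H) * (↑u⁻¹ : E)
      = gSer ℂ (ad ℂ ((u : E) * X * (↑u⁻¹ : E))) ((u : E) * H * (↑u⁻¹ : E)) - (u : E) * H * (↑u⁻¹ : E) := by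
  rw [mul_sub, sub_mul, conj_gSer_ad_apply]

omit [CompleteSpace E] in
/-- Conjugation commutes with scalars: `u(c•X)u⁻¹ = c•(uXu⁻¹)` (so the lemmas apply to `X = iλ`). (bookkeeping) [folklore] -/
theorem conj_smul (u : Eˣ) (c : ℂ) (X : E) : (u : E) * (c • X) * (↑u⁻¹ : E) = c • ((u : E) * X * (↑u⁻¹ : E)) := by
  rw [Algebra.mul_smul_comm, Algebra.smul_mul_assoc]

end Summit.QuantumFields.YangMills.Theorems.Prop7GSerAdEquivariance

end
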